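import Summits.BirchSwinnertonDyer.BirchSwinnertonDyer.Theorems.ErratumRoadFiveTwoVariableControl
import Summits.BirchSwinnertonDyer.BirchSwinnertonDyer.Theorems.ErratumRoadFiveIrrKNoFixedTorsion
import Literature.NumberTheory.EllipticCurves.IwasawaCyclotomicProofs
import Literature.NumberTheory.EllipticCurves.BDPAnticyclotomicPAdicLFunctionSigmaInt
import HarnessLib

/-!
# Erratum Thm. 2.3 «⊂» (F4♯) ON THE (dec) LOCUS from the two-variable core (S1) ALONE — the part of
# crux 25505 `ErratumThm23SigmaLe` that K2 consumes, with NO corner (helper, `--supports stmt-BirchSwinnertonDyer-25505`)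

Cell `bsd-stepL`, seat `bsd-stepL-imc-p1` (prover g22, 2026-08-28). Theorems only (no definition, no named
fact, no `sorry`, no instance, no notation). Sequel of imc-p1 g21's
`ErratumRoadFiveErratumThm23OfTwoVarCoreCorner` (p631770: F4♯ from S1 + the `¬(dec)` corner by a case split).

## What this file proves and why

`erratumThm23SigmaLe_dec_of_twoVarCore (hFW : ‹S1 verbatim›) : ‹F4♯ with the extra binder (dec)›`, where

* S1 = the registered stub `stub_FW21_twoVarSigmaLePinned` of `Cruxes/ErratumThm23SigmaLe/Lines/erratum_chain.lean`
  VERBATIM (the OPEN two-variable core: [FW21, Thm. 4.41] Σ-imprimitive + App. B Cor. 7.21 ∕ L. 7.22 + the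
  weight-`k` [CGS25, Prop. 2.4.5]-type restriction, pinned on `T_c = 0`);
* (dec) = "`A_g` has no non-zero `Γ_{K_𝔭̄}`-fixed `p`-power-torsion element" = erratum Lemma 2.1's own
  printed hypothesis "`H⁰(K_𝔭̄, A_g[ϖ]) = 0`" (p. 2), placed right after `3 < p` exactly where the v3 corner stub
  `stub_cornerLocalTorsion` carries its negation; every other binder and the conclusion are F4♯'s
  (`Castella2018.erratumThm23_charIdeal_sigma_le_of_isTorsion_OPEN`) byte for byte.

The proof is the (dec) branch of p631770 as a standalone theorem: (glob) from `IsResiduallyIrreducible Δ`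
(`IrrK.noFixedTorsion_of_isResiduallyIrreducible'`), (unr) (`cofreeRepOver_localMap_inr_apply_eq_self`), the
one-variable finite generation (`SkinnerUrban2014.moduleFinite_XBig_newform`), the two-variable one and the
EXACT control map (`ControlAt.module_finite_XBig_iterate` ∕ `exists_controlMap`, `Exists.choose` packaging), a
cyclotomic `κ'` (`exists_cyclotomicZpExtension_holds`), and the descent of [JSW17, Cor. 3.4.2]
(`TwoVariableDescent.*`, `CoeffRing.*`).

WHY (memo `HOME/imc-p1/g22/CORNER-25505-imc-p1-g22.md`): K2's deciding theorem `Theses.ErratumRoadFive.closes`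
applies crux 25505 (binder `h23`) ONLY at the Hida members `g_m` of `f_E` on the erratum locus, where (iv)
`E(ℚ_p)[p] = 0` and the congruence (b) `A_{g_m}[p^m] ≅ (𝒪_m ⊗ E[p^∞])[p^m]` give (dec) for `g_m` in the kernel
(`RoadFFMember.forall_fixed_primary_eq_zero_cofreeRepOver` + `BigRep.hdec_geomPoints_of_padicTorsion`). So for
K2 the `¬(dec)` corner of the E-free crux — on whose anomalous-and-locally-split part (`a_p(g) ≡ 1 (mod ϖ)` and
`V_g|_{G_{ℚ_p}}` split) neither [JSW17, Cor. 3.4.2] (its two-variable "easily adapted" finiteness of `𝓜^{G_{K_v}}`,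
p. 14, fails there) nor the erratum supplies an argument — is never entered: along ROAD FF the open input is S1
alone (companion files `ErratumRoadFiveIMCDivRoadFFFittingFrameBOfThm23Dec`, `ErratumRoadFiveClosesOfTwoVarCore`).

HONEST FRAMING: CONDITIONAL on its displayed hypothesis S1 (OPEN: unrefereed [FW21] + the unprinted weight-`k`
CGS computation); no summit statement and no crux is proved here; BSD is proved for no pair; closes: none (T7).

[claim: FouquetWan2021, Thm. 4.41, App. B Cor. 7.21, Lemma 7.22, status: under-review]
[claim: Castella2018Erratum, Thm. 2.3, Lemma 2.1, status: under-review]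
[cite: JetchevSkinnerWan2017, §3.4, Lemma 3.4.1, Cor. 3.4.2 (arXiv:1512.06894 p. 14)]
-/

noncomputable section

open scoped Classical

open PowerSeries NumberField IsDedekindDomain Field
  Literature.NumberTheory.EllipticCurves Literature.NumberTheory.EllipticCurves.ModularForms
  Literature.NumberTheory.EllipticCurves.BigGaloisRep Literature.NumberTheory.EllipticCurves.GreenbergSelmer
  Literature.NumberTheory.GaloisRepresentations

-- D-0017: single-problem summit, the namespace repeats the problem name by design.
set_option linter.dupNamespace false
set_option autoImplicit false

namespace Summit.BirchSwinnertonDyer.BirchSwinnertonDyer.Theorems.ErratumThm23TwoVariable.ErratumChainDec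

set_option maxHeartbeats 800000 in
-- statement-sized packages over the iterated big representation (as `control_newform` ∕ p631770); the proof is glue
/-- **Erratum Thm. 2.3 «⊂» on the (dec) locus from the two-variable core alone.** `hFW` = the registered stub
`stub_FW21_twoVarSigmaLePinned` of the line `erratum_chain` of crux 25505 VERBATIM (OPEN); conclusion = F4♯
(`Castella2018.erratumThm23_charIdeal_sigma_le_of_isTorsion_OPEN`) with ONE extra binder after `3 < p`:
(dec) "no non-zero `Γ_{K_𝔭̄}`-fixed `p`-power torsion in `A_g`" = erratum Lemma 2.1's "`H⁰(K_𝔭̄, A_g[ϖ]) = 0`"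
(for K2's members: (iv) `E(ℚ_p)[p] = 0` through the congruence). Everything else — (glob) from irreducibility,
(unr), finite generation, EXACT two-variable control, a cyclotomic `κ'`, the descent [JSW17 Cor. 3.4.2] — is the tree's.
[cite: Castella2018Erratum, Lemma 2.1 (p. 2) and proof of Thm. 2.3: (2.4) ⇒ (2.5) (p. 4)]
[cite: JetchevSkinnerWan2017, §3.4, Lemma 3.4.1 and Cor. 3.4.2 (arXiv:1512.06894 p. 14)] -/
theorem erratumThm23SigmaLe_dec_of_twoVarCore
    (hFW :
      ∀ {p : ℕ} [Fact p.Prime] (ι : PadicAlgCl p ≃+* ℂ) {M : ℕ} [NeZero M] {k : ℤ}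
        (g : CuspForm (CongruenceSubgroup.Gamma0 M) k) (ιg : coeffField g →+* PadicAlgCl p)
        (Δ : OrdinaryNewformDatum g p ιg)
        (K : Type) [Field K] [NumberField K] (𝔭 𝔭bar : HeightOneSpectrum (𝓞 K)) (κ : ZpExtension K p)
        (γ : absoluteGaloisGroup K) [Fact (κ.IsTopGenerator γ)] (S : Finset (HeightOneSpectrum (𝓞 K))),
        IsNewform0 g → 2 ≤ k → Even k → 3 ≤ M → ¬ p ∣ M → 3 < p →
        (∀ x : coeffField g, ι (ιg x) = (x : ℂ)) →
        ‖ιg ⟨(UpperHalfPlane.qExpansion 1 ⇑g).coeff p, coeff_mem_coeffField g p⟩‖ = 1 →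
        IsImaginaryQuadratic K → (∃ β : ℤ, (4 * M : ℤ) ∣ β ^ 2 - NumberField.discr K) →
        ((Ideal.span {(p : ℤ)}).primesOver (𝓞 K)).ncard = 2 →
        ((p : ℕ) : 𝓞 K) ∈ 𝔭.asIdeal →
        (∀ (w : InfinitePlace K) (x : 𝓞 K), x ∈ 𝔭.asIdeal ↔ ‖ι.symm (w.embedding (x : K))‖ < 1) →
        ((p : ℕ) : 𝓞 K) ∈ 𝔭bar.asIdeal → 𝔭bar ≠ 𝔭 →
        SkinnerUrban2014.IsResiduallyIrreducible Δ →
        (∃ v : HeightOneSpectrum (𝓞 ℚ), SkinnerUrban2014.IsResiduallyRamifiedAt Δ v ∧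
          ((Rat.HeightOneSpectrum.primesEquiv v : Nat.Primes) : ℕ) ∣ M ∧
          ¬ ((Rat.HeightOneSpectrum.primesEquiv v : Nat.Primes) : ℕ) ^ 2 ∣ M ∧
          ((Ideal.span {(((Rat.HeightOneSpectrum.primesEquiv v : Nat.Primes) : ℕ) : ℤ)}).primesOver (𝓞 K)).ncard ≠ 2) →
        (((Ideal.span {(2 : ℤ)}).primesOver (𝓞 K)).ncard ≠ 2 → (2 ∣ M ∧ ¬ 4 ∣ M)) →
        (∀ ℓ : ℕ, ℓ.Prime → ℓ ∣ M → ((Ideal.span {(ℓ : ℤ)}).primesOver (𝓞 K)).ncard ≠ 2 →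
          ¬ ℓ ^ 2 ∣ M ∧ (UpperHalfPlane.qExpansion 1 ⇑g).coeff ℓ = -((ℓ : ℂ) ^ (k / 2 - 1).toNat)) →
        κ.IsAnticyclotomic → (∀ w ∈ S, ((p : ℕ) : 𝓞 K) ∉ w.asIdeal) →
        (∀ w : HeightOneSpectrum (𝓞 K), ((M : ℕ) : 𝓞 K) ∈ w.asIdeal → w ∈ S) →
        ∀ (b : padicCoeffIntegers ιg →+* PadicComplexInt p),
          (∀ x, ((b x : PadicComplexInt p) : ℂ_[p]) =
            algebraMap (PadicAlgCl p) ℂ_[p] (padicCoeffIntegers.toPadicAlgCl ιg x)) →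
        ∀ (ΩK : ℂ) (Ωp : (PadicComplexInt p)ˣ) (Q : PowerSeries (PadicComplexInt p)), ΩK ≠ 0 →
          IsBDPLFunctionWtSigmaInt ι 𝔭 κ γ g S ΩK ((Ωp : PadicComplexInt p) : ℂ_[p]) Q →
        -- the complementary (cyclotomic) direction `κ'` with generator `γ'`: `Γ_K = Γ⁺ ⊕ Γ⁻ ≅ ℤ_p²` for `p` odd
        ∀ (κ' : ZpExtension K p) (γ' : absoluteGaloisGroup K) [Fact (κ'.IsTopGenerator γ')], κ'.IsCyclotomic →
        ∀ [TopologicalSpace (PowerSeries (padicCoeffIntegers ιg))]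
          [TopologicalSpace (PowerSeries (PowerSeries (padicCoeffIntegers ιg)))]
          [ContinuousSMul (PowerSeries (PowerSeries (padicCoeffIntegers ιg)))
            (BigRepModule (PowerSeries (padicCoeffIntegers ιg)) p
              (BigRepModule (padicCoeffIntegers ιg) p (Cofree Δ.ρ (padicCoeffField ιg))))],
        -- premise: `X^Σ_K(A_g)` is `Λ_K`-torsion; conclusion: a two-variable frame pinned to `Q` on `X = 0` dividing `Ch_{Λ_K}(X^Σ_K(A_g))`
        Module.IsTorsion (PowerSeries (PowerSeries (padicCoeffIntegers ιg)))
            (XBig κ' (AnticyclotomicBigGaloisRep κ (Δ.cofreeRepOver K)) 𝔭bar (↑S)) →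
        ∃ Q₂ : PowerSeries (PowerSeries (PadicComplexInt p)),
          (∃ u : (PowerSeries (PadicComplexInt p))ˣ,
              PowerSeries.constantCoeff Q₂ = (u : PowerSeries (PadicComplexInt p)) * Q) ∧
          (XBig.charIdeal κ' (AnticyclotomicBigGaloisRep κ (Δ.cofreeRepOver K)) 𝔭bar (↑S)).map
              (PowerSeries.map (PowerSeries.map b)) ≤ Ideal.span {Q₂}) :
    ∀ {p : ℕ} [Fact p.Prime] (ι : PadicAlgCl p ≃+* ℂ) {M : ℕ} [NeZero M] {k : ℤ}
      (g : CuspForm (CongruenceSubgroup.Gamma0 M) k) (ιg : coeffField g →+* PadicAlgCl p)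
      (Δ : OrdinaryNewformDatum g p ιg)
      (K : Type) [Field K] [NumberField K] (𝔭 𝔭bar : HeightOneSpectrum (𝓞 K)) (κ : ZpExtension K p)
      (γ : absoluteGaloisGroup K) [Fact (κ.IsTopGenerator γ)] (S : Finset (HeightOneSpectrum (𝓞 K))),
      IsNewform0 g → 2 ≤ k → Even k → 3 ≤ M → ¬ p ∣ M → 3 < p →
      -- (dec): no non-zero `Γ_{K_𝔭̄}`-fixed `p`-power torsion in `A_g` (erratum Lemma 2.1: "`H⁰(K_𝔭̄, A_g[ϖ]) = 0`")
      (∀ a : Cofree Δ.ρ (padicCoeffField ιg),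
          (∀ σ : LocalGroup K (Sum.inl 𝔭bar), (Δ.cofreeRepOver K) (localMap K (Sum.inl 𝔭bar) σ) a = a) →
          (∃ j : ℕ, p ^ j • a = 0) → a = 0) →
      (∀ x : coeffField g, ι (ιg x) = (x : ℂ)) →
      ‖ιg ⟨(UpperHalfPlane.qExpansion 1 ⇑g).coeff p, coeff_mem_coeffField g p⟩‖ = 1 →
      IsImaginaryQuadratic K → (∃ β : ℤ, (4 * M : ℤ) ∣ β ^ 2 - NumberField.discr K) →
      ((Ideal.span {(p : ℤ)}).primesOver (𝓞 K)).ncard = 2 →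
      ((p : ℕ) : 𝓞 K) ∈ 𝔭.asIdeal →
      (∀ (w : InfinitePlace K) (x : 𝓞 K), x ∈ 𝔭.asIdeal ↔ ‖ι.symm (w.embedding (x : K))‖ < 1) →
      ((p : ℕ) : 𝓞 K) ∈ 𝔭bar.asIdeal → 𝔭bar ≠ 𝔭 →
      SkinnerUrban2014.IsResiduallyIrreducible Δ →
      (∃ v : HeightOneSpectrum (𝓞 ℚ), SkinnerUrban2014.IsResiduallyRamifiedAt Δ v ∧
        ((Rat.HeightOneSpectrum.primesEquiv v : Nat.Primes) : ℕ) ∣ M ∧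
        ¬ ((Rat.HeightOneSpectrum.primesEquiv v : Nat.Primes) : ℕ) ^ 2 ∣ M ∧
        ((Ideal.span {(((Rat.HeightOneSpectrum.primesEquiv v : Nat.Primes) : ℕ) : ℤ)}).primesOver (𝓞 K)).ncard ≠ 2) →
      (((Ideal.span {(2 : ℤ)}).primesOver (𝓞 K)).ncard ≠ 2 → (2 ∣ M ∧ ¬ 4 ∣ M)) →
      (∀ ℓ : ℕ, ℓ.Prime → ℓ ∣ M → ((Ideal.span {(ℓ : ℤ)}).primesOver (𝓞 K)).ncard ≠ 2 →
        ¬ ℓ ^ 2 ∣ M ∧ (UpperHalfPlane.qExpansion 1 ⇑g).coeff ℓ = -((ℓ : ℂ) ^ (k / 2 - 1).toNat)) →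
      κ.IsAnticyclotomic → (∀ w ∈ S, ((p : ℕ) : 𝓞 K) ∉ w.asIdeal) →
      (∀ w : HeightOneSpectrum (𝓞 K), ((M : ℕ) : 𝓞 K) ∈ w.asIdeal → w ∈ S) →
      ∀ (b : padicCoeffIntegers ιg →+* PadicComplexInt p),
        (∀ x, ((b x : PadicComplexInt p) : ℂ_[p]) =
          algebraMap (PadicAlgCl p) ℂ_[p] (padicCoeffIntegers.toPadicAlgCl ιg x)) →
      ∀ (ΩK : ℂ) (Ωp : (PadicComplexInt p)ˣ) (Q : PowerSeries (PadicComplexInt p)), ΩK ≠ 0 →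
        IsBDPLFunctionWtSigmaInt ι 𝔭 κ γ g S ΩK ((Ωp : PadicComplexInt p) : ℂ_[p]) Q →
      ∀ [TopologicalSpace (PowerSeries (padicCoeffIntegers ιg))]
        [ContinuousSMul (PowerSeries (padicCoeffIntegers ιg))
          (BigRepModule (padicCoeffIntegers ιg) p (Cofree Δ.ρ (padicCoeffField ιg)))],
      Module.IsTorsion (PowerSeries (padicCoeffIntegers ιg)) (XBig κ (Δ.cofreeRepOver K) 𝔭bar (↑S)) →
      (XBig.charIdeal κ (Δ.cofreeRepOver K) 𝔭bar (↑S)).map (PowerSeries.map b) ≤ Ideal.span {Q} := by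
  intro p _ ι M _ k g ιg Δ K _ _ 𝔭 𝔭bar κ γ _ S h1 h2 h3 h4 h5 h6 hdec h7 h8 h9 h10 h11 h12 h13 h14 h15 h16 h17
    h18 h19 h20 h21 h22 b h23 ΩK Ωp Q h24 h25 _i1 _i2 h26
  -- (glob) from irreducibility (tree theorem)
  have hglob := IrrK.noFixedTorsion_of_isResiduallyIrreducible' Δ K h6 h9 h16
  -- a cyclotomic `ℤ_p`-extension with a topological generator; any topology on `Λ_K` (the conclusion does not see it)
  obtain ⟨κ', hκ'⟩ := Literature.NumberTheory.EllipticCurves.exists_cyclotomicZpExtension_holds K p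
  obtain ⟨γ', hγ'⟩ := κ'.surjective (Multiplicative.ofAdd 1)
  haveI : Fact (κ'.IsTopGenerator γ') := ⟨hγ'⟩
  letI : TopologicalSpace (PowerSeries (PowerSeries (padicCoeffIntegers ιg))) := ⊥
  haveI : DiscreteTopology (PowerSeries (PowerSeries (padicCoeffIntegers ιg))) := ⟨rfl⟩
  -- (unr) and the one-variable finite generation, from the tree
  have hSM' : ∀ w : HeightOneSpectrum (𝓞 K), w ∉ (↑S : Set (HeightOneSpectrum (𝓞 K))) →
      ((M : ℕ) : 𝓞 K) ∉ w.asIdeal := fun w hw hM ↦ hw (Finset.mem_coe.2 (h22 w hM))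
  have hunr := OrdinaryNewformDatum.cofreeRepOver_localMap_inr_apply_eq_self Δ (K := K) (↑S) hSM'
  haveI : Module.Finite (PowerSeries (padicCoeffIntegers ιg)) (XBig κ (Δ.cofreeRepOver K) 𝔭bar (↑S)) :=
    SkinnerUrban2014.moduleFinite_XBig_newform Δ (CoeffRing.finiteDimensional_padicCoeffField ιg h1) K κ
      𝔭bar (↑S) S.finite_toSet hSM'
  haveI := ControlAt.module_finite_XBig_iterate κ κ' (Δ.cofreeRepOver K) 𝔭bar (↑S) hglob hdec hunr
  -- the EXACT control map (kernel zero, hence pseudo-null), packaged with `Exists.choose`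
  have key := ControlAt.exists_controlMap κ κ' (Δ.cofreeRepOver K) 𝔭bar (↑S) hglob hdec hunr
  -- ring-theoretic clauses for the newform's coefficient ring (as in `AtData…`, p611089 §1)
  haveI := CoeffRing.finiteDimensional_padicCoeffField ιg h1
  haveI : IsPrincipalIdealRing (padicCoeffIntegers ιg) := CoeffRing.isPrincipalIdealRing ιg
  haveI : UniqueFactorizationMonoid (PowerSeries (PowerSeries (padicCoeffIntegers ιg))) :=
    CoeffRing.uniqueFactorizationMonoid_powerSeries_powerSeries ιg
  -- two-variable torsion from the one-variable torsion premise + control (determinant trick)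
  have hs := TwoVariableDescent.exists_constantCoeff_ne_zero_of_control
    (A := PowerSeries (padicCoeffIntegers ιg))
    (XBig κ' (AnticyclotomicBigGaloisRep κ (Δ.cofreeRepOver K)) 𝔭bar (↑S))
    (XBig κ (Δ.cofreeRepOver K) 𝔭bar (↑S)) h26 key.choose key.choose_spec.2.2
  have htors₂ := TwoVariableDescent.isTorsion_of_exists_constantCoeff_ne_zero
    (A := PowerSeries (padicCoeffIntegers ιg))
    (XBig κ' (AnticyclotomicBigGaloisRep κ (Δ.cofreeRepOver K)) 𝔭bar (↑S)) hs
  -- the two-variable core (S1), for this cyclotomic `κ'`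
  obtain ⟨Q₂, ⟨u, hu⟩, hle⟩ := hFW ι g ιg Δ K 𝔭 𝔭bar κ γ S h1 h2 h3 h4 h5 h6 h7 h8 h9 h10 h11 h12 h13
    h14 h15 h16 h17 h18 h19 h20 h21 h22 b h23 ΩK Ωp Q h24 h25 κ' γ' hκ' htors₂
  -- descent of the characteristic ideal along `T_c ↦ 0` (JSW Cor. 3.4.2, kernel form), read in `𝓞_{ℂ_p}`
  have hdesc := TwoVariableDescent.charIdeal_le_map_constantCoeff_of_control
    (A := PowerSeries (padicCoeffIntegers ιg))
    (XBig κ' (AnticyclotomicBigGaloisRep κ (Δ.cofreeRepOver K)) 𝔭bar (↑S))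
    (XBig κ (Δ.cofreeRepOver K) 𝔭bar (↑S)) h26 key.choose key.choose_spec.1 key.choose_spec.2.2
  refine (Ideal.map_mono hdesc).trans ?_
  rw [TwoVariableDescent.map_map_constantCoeff_eq b]
  exact TwoVariableDescent.map_constantCoeff_le_span_of_le_span_of_eq_unit_mul hle hu

end Summit.BirchSwinnertonDyer.BirchSwinnertonDyer.Theorems.ErratumThm23TwoVariable.ErratumChainDec

end
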